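import Literature.NumberTheory.QuadraticFields.HeegnerCondition
import Mathlib.RingTheory.Ideal.Operations
import Mathlib.RingTheory.Int.Basic
import HarnessLib

/-!
# Ideals of a quadratic ring attached to binary quadratic forms: the lattice `ℤA ⊕ ℤ(ω − k)`

Topic `NumberTheory/QuadraticFields`, namespace `Literature.NumberTheory.QuadraticFields.Quadratic`
(continuing `HeegnerCondition.lean`, which supplies a `ℤ`-basis `(1, ω)` of `𝓞 K` for a
quadratic field, `exists_basis_zero_eq_one`, with `ω² = m + tω`, `basis_one_mul_self_eq`, and
`d_K = t² + 4m`, `discr_eq_sq_add_four_mul`). Everything here is PROVED (theorems only).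

This is the first file of the elementary **form–ideal dictionary** for an imaginary quadratic
field (Cox, *Primes of the form x² + ny²*, §7.B, Thm. 7.7: the ideal `[a, (−b + √D)/2]` of a form
`(a, b, c)` of discriminant `D`), needed to count the `Γ₀(N)`-classes of Heegner forms by the class
number (`Literature.NumberTheory.EllipticCurves.HeegnerDatum.card_reps_eq_classNumber`, Gross 1984,
§I.1; Gross–Kohnen–Zagier 1987, §I.1). We work in a commutative ring `R` with a `ℤ`-basis
`b = (1, ω)`, `ω² = m + tω` (a *quadratic ring*; `R = 𝓞 K` in the applications), and write the
generator `(−B + √D)/2` as `η = ω − k` with `B = 2k − t` (so that no division by `2` occurs;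
`√D = δ = 2ω − t`):

* coordinates: `x = x₀ + x₁ω` (`eq_repr_add_repr_mul_of_basis`) and their uniqueness
  (`intCast_add_intCast_mul_inj`);
* `η² = (t − 2k)η − n` with `n = k² − tk − m = N(η)` (`sub_mul_sub_eq`), `ω·η = (t − k)η − n`;
* **the ideal `(A, η)` is the lattice `ℤA ⊕ ℤη`** as soon as `A ∣ n`, i.e. `AC = k² − tk − m` —
  the form `(A, 2k − t, C)` then has discriminant `t² + 4m = d_K`
  (`mem_span_pair_iff_of_basis`, Cox, (7.9)/Exercise 7.11: "`[a, (−b+√D)/2]` is an ideal"), with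
  unique lattice coordinates (`lattice_coords_unique`);
* `x · x̄ ∈ ℤ ∖ {0}` for `x ≠ 0` in a quadratic domain (`add_mul_mul_conj`,
  `exists_intCast_ne_zero_mem_span`);
* for `R = 𝓞 K`: **every form of discriminant `d_K` is primitive** (`isUnit_of_dvd_of_disc_eq`:
  if a prime `p` divided `A, B, C` then `w = (D/p² + δ/p)/2` would be an algebraic integer with
  `ω`-coordinate `1/p`; i.e. `d_K` is a fundamental discriminant, Cox §2.A/Thm. 5.? "`d_K`
  fundamental").

Mathlib (pin v4.32.0) has `Module.Basis`, `Ideal.mem_span_pair`, `IsIntegralClosure.mk'`, but no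
quadratic rings/orders or form–ideal correspondence (searched `QuadraticField`, `binaryQuadratic`,
`span_pair` + `lattice`: nothing relevant; `QuadraticAlgebra R a b` is the abstract algebra
`R[X]/(X² − bX − a)`, not tied to `𝓞 K`).

## References

* D. A. Cox, *Primes of the form x² + ny²*, 2nd ed., Wiley (2013), §5.B (fundamental
  discriminant `d_K`, (5.11)), §7.A–B (orders, proper ideals `[a, (−b + √D)/2]`, (7.9), Thm. 7.7).
* B. H. Gross, *Heegner points on `X₀(N)`*, in *Modular Forms* (Durham 1983), Horwood (1984),
  87–105, §I.1.
-/

noncomputable section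

open Module NumberField

namespace Literature.NumberTheory.QuadraticFields.Quadratic

section QuadraticRing

variable {R : Type*} [CommRing R] (b : Basis (Fin 2) ℤ R) (hb : b 0 = 1)

/-! ### Coordinates with respect to a basis `(1, ω)` -/

include hb in
/-- Every element of a quadratic ring with `ℤ`-basis `(1, ω)` is `x₀ + x₁ ω` with `x₀, x₁ ∈ ℤ` its
coordinates. [folklore] -/
theorem eq_repr_add_repr_mul_of_basis (x : R) :
    x = (b.repr x 0 : R) + (b.repr x 1 : R) * b 1 := by
  conv_lhs => rw [← b.sum_repr x]
  rw [Fin.sum_univ_two, hb, zsmul_eq_mul, mul_one, zsmul_eq_mul]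

include hb in
/-- The first coordinate of `u + v ω` is `u`. [folklore] -/
theorem repr_intCast_add_intCast_mul_zero (u v : ℤ) :
    b.repr ((u : R) + (v : R) * b 1) 0 = u := by
  have h : (u : R) + (v : R) * b 1 = u • b 0 + v • b 1 := by
    rw [hb, zsmul_eq_mul, mul_one, zsmul_eq_mul]
  rw [h, map_add, map_zsmul, map_zsmul, b.repr_self, b.repr_self]
  simp

include hb in
/-- The second coordinate of `u + v ω` is `v`. [folklore] -/
theorem repr_intCast_add_intCast_mul_one (u v : ℤ) :
    b.repr ((u : R) + (v : R) * b 1) 1 = v := by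
  have h : (u : R) + (v : R) * b 1 = u • b 0 + v • b 1 := by
    rw [hb, zsmul_eq_mul, mul_one, zsmul_eq_mul]
  rw [h, map_add, map_zsmul, map_zsmul, b.repr_self, b.repr_self]
  simp

include hb in
/-- **Uniqueness of coordinates**: `u + v ω = u' + v' ω` forces `u = u'` and `v = v'`. [folklore] -/
theorem intCast_add_intCast_mul_inj {u v u' v' : ℤ}
    (h : (u : R) + (v : R) * b 1 = (u' : R) + (v' : R) * b 1) : u = u' ∧ v = v' := by
  constructor
  · have h1 := repr_intCast_add_intCast_mul_zero b hb u v
    rw [h, repr_intCast_add_intCast_mul_zero b hb] at h1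
    exact h1.symm
  · have h1 := repr_intCast_add_intCast_mul_one b hb u v
    rw [h, repr_intCast_add_intCast_mul_one b hb] at h1
    exact h1.symm

include hb in
/-- A quadratic ring with `ℤ`-basis `(1, ω)` has characteristic zero: an integer vanishing in `R`
is `0`. [folklore] -/
theorem intCast_eq_zero_of_basis {n : ℤ} (h : (n : R) = 0) : n = 0 := by
  have h' : (n : R) + ((0 : ℤ) : R) * b 1 = ((0 : ℤ) : R) + ((0 : ℤ) : R) * b 1 := by
    rw [h]; push_cast; ring
  exact (intCast_add_intCast_mul_inj b hb h').1

include hb in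
/-- `ω ∉ ℤ`: an element `u + v ω` with `v ≠ 0` is not an integer; in particular
`2ω − t ≠ 0`, so `(2ω − t)² = t² + 4m ≠ 0` in a domain (used as: the discriminant of a quadratic
ring is non-zero). [folklore] -/
theorem intCast_add_intCast_mul_ne_intCast {u v : ℤ} (hv : v ≠ 0) (n : ℤ) :
    (u : R) + (v : R) * b 1 ≠ n := by
  intro h
  have h' : (u : R) + (v : R) * b 1 = (n : R) + ((0 : ℤ) : R) * b 1 := by
    rw [h]; push_cast; ring
  exact hv (intCast_add_intCast_mul_inj b hb h').2

/-! ### The quadratic relation `ω² = m + tω` and the element `η = ω − k` -/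

variable {t m : ℤ} (hω : b 1 * b 1 = (m : R) + (t : R) * b 1)

include hω in
/-- For `η = ω − k`: `η² = (t − 2k) η − n` with `n = k² − tk − m` (the norm of `η`; with
`B = 2k − t` and `D = t² + 4m` this reads `η² = −Bη − (B² − D)/4`, i.e. `η = (−B + √D)/2`).
[folklore] -/
theorem sub_mul_sub_eq (k : ℤ) :
    (b 1 - k) * (b 1 - k) = ((t - 2 * k : ℤ) : R) * (b 1 - k) - ((k ^ 2 - t * k - m : ℤ) : R) := by
  push_cast
  linear_combination hω

include hω in
/-- `ω · η = (t − k) η − n` for `η = ω − k`, `n = k² − tk − m`. [folklore] -/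
theorem basis_one_mul_sub_eq (k : ℤ) :
    b 1 * (b 1 - k) = ((t - k : ℤ) : R) * (b 1 - k) - ((k ^ 2 - t * k - m : ℤ) : R) := by
  push_cast
  linear_combination hω

include hω in
/-- The conjugate `x̄ = (u + tv) − vω` of `x = u + vω` has `x x̄ = u² + tuv − mv² ∈ ℤ` (the norm
form of the quadratic ring). [folklore] -/
theorem add_mul_mul_conj (u v : ℤ) :
    ((u : R) + (v : R) * b 1) * (((u + t * v : ℤ) : R) - (v : R) * b 1) =
      ((u ^ 2 + t * u * v - m * v ^ 2 : ℤ) : R) := by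
  push_cast
  linear_combination (-(v : R) ^ 2) * hω

include hb hω in
/-- In a quadratic *domain*, every non-zero element `x` has a non-zero integer multiple... more
precisely a non-zero integer in the ideal `(x)`, namely `x x̄` (`add_mul_mul_conj`). [folklore] -/
theorem exists_intCast_ne_zero_mem_span [IsDomain R] {x : R} (hx : x ≠ 0) :
    ∃ n : ℤ, n ≠ 0 ∧ (n : R) ∈ Ideal.span {x} := by
  obtain ⟨u, v, rfl⟩ : ∃ u v : ℤ, x = u + v * b 1 := ⟨_, _, eq_repr_add_repr_mul_of_basis b hb x⟩
  refine ⟨u ^ 2 + t * u * v - m * v ^ 2, ?_, ?_⟩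
  · intro h0
    have hconj : (((u + t * v : ℤ) : R) - (v : R) * b 1) = 0 := by
      have hprod := add_mul_mul_conj b hω u v
      rw [h0, Int.cast_zero] at hprod
      exact (mul_eq_zero.mp hprod).resolve_left hx
    have h' : ((u + t * v : ℤ) : R) + ((-v : ℤ) : R) * b 1 = ((0 : ℤ) : R) + ((0 : ℤ) : R) * b 1 := by
      push_cast at hconj ⊢
      linear_combination hconj
    obtain ⟨h1, h2⟩ := intCast_add_intCast_mul_inj b hb h'
    have hv : v = 0 := by omega
    have hu : u = 0 := by rw [hv] at h1; simpa using h1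
    apply hx
    rw [hu, hv]
    push_cast
    ring
  · rw [← add_mul_mul_conj b hω u v]
    exact Ideal.mul_mem_right _ _ (Ideal.mem_span_singleton_self _)

/-! ### The ideal `(A, η)` is the lattice `ℤA ⊕ ℤη` -/

include hb hω in
/-- **The ideal of a form is a lattice** (Cox, *Primes of the form x² + ny²*, §7.A (7.9) and
Exercise 7.11: for a form `(a, b, c)` of discriminant `D`, `[a, (−b + √D)/2]` is an ideal of the
order of discriminant `D`). If `AC = k² − tk − m` — i.e. `A` divides the norm of `η = ω − k`,
equivalently the form `(A, 2k − t, C)` has discriminant `t² + 4m` — then the ideal generated by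
`A` and `η` is exactly the set of `uA + vη`, `u, v ∈ ℤ`. [cite: Cox2013, §7.A (7.9) and §7.B Thm. 7.7] -/
theorem mem_span_pair_iff_of_basis {A k C : ℤ} (hn : A * C = k ^ 2 - t * k - m) (x : R) :
    x ∈ Ideal.span {(A : R), b 1 - k} ↔ ∃ u v : ℤ, x = u * A + v * (b 1 - k) := by
  constructor
  · intro hx
    obtain ⟨r, s, hrs⟩ := Ideal.mem_span_pair.mp hx
    obtain ⟨r₀, r₁, rfl⟩ : ∃ r₀ r₁ : ℤ, r = r₀ + r₁ * b 1 :=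
      ⟨_, _, eq_repr_add_repr_mul_of_basis b hb r⟩
    obtain ⟨s₀, s₁, rfl⟩ : ∃ s₀ s₁ : ℤ, s = s₀ + s₁ * b 1 :=
      ⟨_, _, eq_repr_add_repr_mul_of_basis b hb s⟩
    refine ⟨r₀ + r₁ * k - s₁ * C, r₁ * A + s₀ + s₁ * (t - k), ?_⟩
    rw [← hrs]
    have hn' := congrArg (Int.cast : ℤ → R) hn
    push_cast at hn' ⊢
    linear_combination (s₁ : R) * hω + (s₁ : R) * hn'
  · rintro ⟨u, v, rfl⟩
    exact Ideal.add_mem _ (Ideal.mul_mem_left _ _ (Ideal.subset_span (by simp)))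
      (Ideal.mul_mem_left _ _ (Ideal.subset_span (by simp)))

include hb in
/-- **Uniqueness of lattice coordinates**: for `A ≠ 0`, `uA + vη = u'A + v'η` (`η = ω − k`) forces
`u = u'`, `v = v'` (`A` and `η` are `ℤ`-independent). [folklore] -/
theorem lattice_coords_unique {A k u v u' v' : ℤ} (hA : A ≠ 0)
    (h : (u : R) * A + v * (b 1 - k) = u' * A + v' * (b 1 - k)) : u = u' ∧ v = v' := by
  have h' : ((u * A - v * k : ℤ) : R) + (v : R) * b 1 =
      ((u' * A - v' * k : ℤ) : R) + (v' : R) * b 1 := by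
    push_cast
    linear_combination h
  obtain ⟨h1, h2⟩ := intCast_add_intCast_mul_inj b hb h'
  subst h2
  refine ⟨?_, rfl⟩
  have h3 : u * A = u' * A := by linarith
  exact mul_right_cancel₀ hA h3

include hb hω in
/-- Membership of an integer in the lattice ideal: `(n : R) ∈ (A, η)` iff `A ∣ n` (for
`AC = k² − tk − m`). [folklore] -/
theorem intCast_mem_span_pair_iff {A k C : ℤ} (hn : A * C = k ^ 2 - t * k - m) (n : ℤ) :
    (n : R) ∈ Ideal.span {(A : R), b 1 - k} ↔ A ∣ n := by
  rw [mem_span_pair_iff_of_basis b hb hω hn]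
  constructor
  · rintro ⟨u, v, huv⟩
    have h' : (n : R) * 1 + 0 * (b 1 - k) = u * A + v * (b 1 - k) := by
      rw [← huv]; ring
    have h'' : ((n : ℤ) : R) * ((1 : ℤ) : R) + ((0 : ℤ) : R) * (b 1 - k) =
        ((u * A : ℤ) : R) * ((1 : ℤ) : R) + (v : R) * (b 1 - k) := by
      push_cast
      linear_combination h'
    obtain ⟨h1, -⟩ := lattice_coords_unique b hb one_ne_zero h''
    exact ⟨u, by rw [h1, mul_comm]⟩
  · rintro ⟨c, rfl⟩
    exact ⟨c, 0, by push_cast; ring⟩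

end QuadraticRing

/-! ### Forms of discriminant `d_K` are primitive -/

section RingOfIntegers

variable {K : Type*} [Field K] [NumberField K]

/-- **Every form of fundamental discriminant is primitive.** Let `(1, ω)` be an integral basis of
the quadratic field `K`, `ω² = m + tω` (so `d_K = t² + 4m`, `HeegnerCondition`). If
`B² − 4AC = t² + 4m` then `gcd(A, B, C) = 1`: were a prime `p` to divide `A, B, C`, then
`D' = d_K/p²` would be a discriminant (`≡ 0, 1 mod 4`) and `w = (D' + δ/p)/2`, `δ = 2ω − t = √d_K`,
a root of `X² − D'X + (D'² − D')/4 ∈ ℤ[X]`, hence in `𝓞 K = ℤ ⊕ ℤω` — but its `ω`-coordinate is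
`1/p`. (This is "`d_K` is a fundamental discriminant", Cox §5.B; forms of discriminant `d_K` are
automatically primitive, as used by Gross 1984, §I.1.) [folklore] -/
theorem isUnit_of_dvd_of_disc_eq (b : Basis (Fin 2) ℤ (𝓞 K)) (hb : b 0 = 1) {t m : ℤ}
    (hω : b 1 * b 1 = (m : 𝓞 K) + (t : 𝓞 K) * b 1) {A B C : ℤ}
    (hdisc : B ^ 2 - 4 * A * C = t ^ 2 + 4 * m) {d : ℤ} (hdA : d ∣ A) (hdB : d ∣ B)
    (hdC : d ∣ C) : IsUnit d := by
  by_contra hd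
  -- a prime factor `p` of `d`
  obtain ⟨p, hp, hpd⟩ : ∃ p : ℤ, Prime p ∧ p ∣ d := by
    rcases eq_or_ne d 0 with rfl | hd0
    · exact ⟨2, Int.prime_two, dvd_zero 2⟩
    · refine Int.exists_prime_and_dvd ?_
      intro h1
      exact hd (Int.isUnit_iff_natAbs_eq.mpr h1)
  obtain ⟨A', rfl⟩ := hpd.trans hdA
  obtain ⟨B', rfl⟩ := hpd.trans hdB
  obtain ⟨C', rfl⟩ := hpd.trans hdC
  have hp0 : p ≠ 0 := hp.ne_zero
  set D' : ℤ := B' ^ 2 - 4 * A' * C' with hD'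
  have hDD' : t ^ 2 + 4 * m = p ^ 2 * D' := by rw [← hdisc, hD']; ring
  -- `4 ∣ D'² - D'`
  obtain ⟨e, he⟩ : (4 : ℤ) ∣ D' ^ 2 - D' := by
    have h4 : D' % 4 = 0 ∨ D' % 4 = 1 := by
      rcases Int.even_or_odd B' with ⟨r, hr⟩ | ⟨r, hr⟩
      · left
        have : D' = 0 + 4 * (r ^ 2 - A' * C') := by rw [hD', hr]; ring
        rw [this, Int.add_mul_emod_self_left]; rfl
      · right
        have : D' = 1 + 4 * (r ^ 2 + r - A' * C') := by rw [hD', hr]; ring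
        rw [this, Int.add_mul_emod_self_left]; rfl
    rcases h4 with h | h
    · obtain ⟨q, hq⟩ : (4 : ℤ) ∣ D' := Int.dvd_of_emod_eq_zero h
      exact ⟨q * D' - q, by rw [hq]; ring⟩
    · have hmod : (1 : ℤ) ≡ D' [ZMOD 4] := by rw [Int.ModEq, h]; rfl
      obtain ⟨q, hq⟩ : (4 : ℤ) ∣ D' - 1 := hmod.dvd
      exact ⟨q * D', by linear_combination D' * hq⟩
  -- the algebraic integer `w = (D' + δ/p)/2`
  set δ : 𝓞 K := 2 * b 1 - t with hδ
  have hδsq : δ ^ 2 = ((p ^ 2 * D' : ℤ) : 𝓞 K) := by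
    rw [← hDD', hδ]
    push_cast
    linear_combination (4 : 𝓞 K) * hω
  set δK : K := algebraMap (𝓞 K) K δ with hδKdef
  set w : K := ((D' : K) + δK / p) / 2 with hw
  have hpK : (p : K) ≠ 0 := by exact_mod_cast hp0
  have hδK : δK ^ 2 = (p : K) ^ 2 * D' := by
    rw [hδKdef, ← map_pow, hδsq, map_intCast]
    push_cast
    ring
  have hwrel : w ^ 2 - (D' : K) * w + (e : K) = 0 := by
    have he' : (4 : K) * e = (D' : K) ^ 2 - D' := by exact_mod_cast he.symm
    have h2w : 2 * w - D' = δK / p := by rw [hw]; ring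
    have hsq : (2 * w - D') ^ 2 = (D' : K) := by
      rw [h2w, div_pow, hδK]
      field_simp
    linear_combination (1 / 4 : K) * hsq + (1 / 4 : K) * he'
  have hint : IsIntegral ℤ w := by
    refine ⟨Polynomial.X ^ 2 - Polynomial.C D' * Polynomial.X + Polynomial.C e, ?_, ?_⟩
    · rw [sub_add_eq_add_sub, sub_eq_add_neg, add_assoc]
      refine (Polynomial.monic_X_pow 2).add_of_left ?_
      refine lt_of_le_of_lt (Polynomial.degree_add_le _ _) ?_
      rw [Polynomial.degree_X_pow, Polynomial.degree_neg]
      refine max_lt (lt_of_le_of_lt Polynomial.degree_C_le (by norm_num)) ?_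
      exact lt_of_le_of_lt (Polynomial.degree_C_mul_X_le _) (by norm_num)
    · rw [Polynomial.eval₂_add, Polynomial.eval₂_sub, Polynomial.eval₂_pow, Polynomial.eval₂_mul,
        Polynomial.eval₂_C, Polynomial.eval₂_X, Polynomial.eval₂_C, eq_intCast, eq_intCast]
      exact hwrel
  set z : 𝓞 K := IsIntegralClosure.mk' (𝓞 K) w hint with hzdef
  have hz : algebraMap (𝓞 K) K z = w := IsIntegralClosure.algebraMap_mk' (𝓞 K) w hint
  -- `2p z = pD' - t + 2ω` in `𝓞 K`
  have hzrel : ((2 * p : ℤ) : 𝓞 K) * z = ((p * D' - t : ℤ) : 𝓞 K) + ((2 : ℤ) : 𝓞 K) * b 1 := by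
    apply IsFractionRing.injective (𝓞 K) K
    have hb1 : algebraMap (𝓞 K) K (b 1) = δK / 2 + (t : K) / 2 := by
      rw [hδKdef, hδ, map_sub, map_mul, map_ofNat, map_intCast]
      ring
    rw [map_mul, map_add, map_mul, map_intCast, map_intCast, map_intCast, hz, hw, hb1]
    push_cast
    field_simp
    ring
  -- compare `ω`-coordinates: `2p · z₁ = 2`
  obtain ⟨z₀, z₁, hz01⟩ : ∃ z₀ z₁ : ℤ, z = z₀ + z₁ * b 1 :=
    ⟨_, _, eq_repr_add_repr_mul_of_basis b hb z⟩
  rw [hz01] at hzrel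
  have h' : ((2 * p * z₀ : ℤ) : 𝓞 K) + ((2 * p * z₁ : ℤ) : 𝓞 K) * b 1 =
      ((p * D' - t : ℤ) : 𝓞 K) + ((2 : ℤ) : 𝓞 K) * b 1 := by
    rw [← hzrel]; push_cast; ring
  obtain ⟨-, h2⟩ := intCast_add_intCast_mul_inj b hb h'
  have hpu : IsUnit p := isUnit_iff_exists_inv.mpr ⟨z₁, by linarith⟩
  exact hp.not_unit hpu

end RingOfIntegers

end Literature.NumberTheory.QuadraticFields.Quadratic

end
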